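import Literature.NumberTheory.EllipticCurves.HeegnerPointsKolyvaginSplitDescentProofs
import HarnessLib

/-!
# Kolyvagin's descent modulo `p^M`, split form: the DATA carrier without the Čebotarev and
# duality axioms (`SplitDataM`), so that the `p = 2` pair model can instantiate it

Companion of `HeegnerPointsKolyvaginSplitDescentProofs` (`KolyvaginDescent.SplitHypothesesM`: two
eigengroups `V^{±} ≤ V`, the Selmer group, local conditions, Kolyvagin primes with their strict
conditions `A ℓ`, the Heegner class `x`, `M₀`, Kolyvagin's classes `c(n)` with McCallum's Lemma 4.3
and Prop. 4.4 — AND two analytic axioms: `duality` (Lemma 5.3 + Prop. 2.2) and `cebotarev`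
(Cor. 3.2 for INDEPENDENT pure families, in kernel form)).

WHY THIS FILE. In the reading at `p = 2` for which the split form was designed (Kolyvagin, Izv. 1989
§3: the pair `(E, E^{(d_K)})` over `ℚ`, `V = H¹(ℚ, E[2^M]) × H¹(ℚ, E^{(d_K)}[2^M])`, `A ℓ` = vanishing
at `ℓ`, `Frob_ℓ = τ` on `E[2^M] ≅ ℤ/2^M[τ]` for `Δ(E) < 0`) the field `cebotarev` is UNSATISFIABLE:
for `h ≠ 0` in `H¹(ℚ, E[2])` the independent pure family `{(jh, 0), (0, j′h)}` (`j, j′` induced by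
`E[2] = E^D[2] ↪ E^{(D)}[2^M]`) admits the prescription "(full, zero)" at NO Kolyvagin prime, since
both localisation maps `H¹(ℚ_ℓ, E[2]) → H¹(ℚ_ℓ, E^{(D)}[2^M])` are injective
(`(2R)^{±τ} = 2·R^{±τ}` in `R = ℤ/2^M[τ]`). So no `S : SplitHypothesesM` exists there and every
theorem quantified over it is vacuous at `2` (BSD route `CMKolyvaginAtInertTwo`, crux
`CMKolyvaginExactAtInertTwo`, seat `bsd-line-cmk2-p1` g12 memo `MEMO-T5-adaptive-splitting` §1.4 and
g13). The correct Čebotarev input at `2` compares bottoms MODULO `Δ = ker(V → H¹(K, E[2^M]))` and is a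
HYPOTHESIS of the theorems that need it (e.g. the order-form binder `hCeb₂` of
`Summit.….KolyvaginAdaptiveTwo.card_mul_card_le_of_casselsTate_adaptive`), not a field. This file
therefore provides the bare data carrier:

* `KolyvaginDescent.SplitDataM V Pl` — `SplitHypothesesM` with the fields `duality` and `cebotarev`
  REMOVED (everything else verbatim: these are definitions, tags and McCallum's Lemma 4.3 /
  Prop. 4.4, all meaningful at every prime);
* `SplitDataM.expo` (`ord s = p^{expo s}`) with a PUBLIC API (`expo_spec`, `expo_le_iff`,
  `expo_le_M_and_eq_zero_iff`, `addOrderOf_eq_pow_expo`, `expo_x_and_zsmul_x_eq_zero_iff`; the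
  sibling keeps its analogues private), signs, and square-free products with one more prime;
* `SplitHypothesesM.toData` — the forgetful map (`S.toData.expo = S.expo` holds by `rfl`).

No theorem of substance, no named fact; nothing here is a claim about BSD.

## References

* W. G. McCallum, *Kolyvagin's work on Shafarevich–Tate groups*, in *`L`-functions and arithmetic
  (Durham 1989)*, LMS Lecture Note Ser. 153 (1991) 295–316: §§3–5 (Cor. 3.2, Lemma 4.3, Prop. 4.4,
  Lemma 5.1, Lemma 5.3) (held `book:editornd-l-functions-arithmetic`, PDF pp. 276–290). [McCallumLMS1991]
* B. H. Gross, *Kolyvagin's work on modular elliptic curves*, same volume: Prop. 5.4 (2), §10. [GrossLMS1991]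
* V. A. Kolyvagin, Izv. 1989: Thm. `B_l` at `l = 2`, §3 (the pair `(E, E^D)` over `ℚ`). [Kolyvagin1989Izv]
-/

noncomputable section

open scoped Classical

namespace Literature.NumberTheory.EllipticCurves

namespace KolyvaginDescent

/-! ## The data carrier -/

/-- **The data of Kolyvagin's descent modulo `p^M`, split form, WITHOUT the analytic axioms**
(any prime `p`). Identical to `KolyvaginDescent.SplitHypothesesM` (see its docstring for the
dictionary with McCallum 1991 §§2–5) except that the fields `duality` (Lemma 5.3 + Prop. 2.2) and
`cebotarev` (Cor. 3.2 for independent pure families, kernel form — unsatisfiable in the `p = 2` pair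
model, see the module docstring) are omitted; theorems take the analytic inputs they consume as
hypotheses. Fields: the prime `p` and level `M` (`V` killed by `p^M`), eigengroups `eig (±1)`
meeting in `0`, the Selmer group `Sel` (split, cut out by local conditions `Loc v`), Kolyvagin
primes `Kol ℓ` with their place `pl ℓ`, divisibility `Dv` and strict conditions `A ℓ` ("`c_λ = 0`"),
the class `x ∈ Sel ∩ V^{ε}` of order `p^M`, `M₀` (`c 1 = p^{M₀} x`, McCallum Lemma 5.1), and
Kolyvagin's classes `c n` with their signs (Gross 1991 Prop. 5.4 (2)), McCallum's Lemma 4.3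
(`c_mem_loc`) and Prop. 4.4 (`c_mem_loc_iff`). [cite: McCallumLMS1991, §§3–5 (Lemma 4.3, Prop. 4.4, Lemma 5.1)]
[cite: GrossLMS1991, Prop. 5.4 (2), §10] [cite: Kolyvagin1989Izv, §3 (the frame over ℚ at l = 2)] -/
structure SplitDataM (V : Type*) [AddCommGroup V] (Pl : Type*) where
  /-- The prime `p` (any prime, `2` allowed). -/
  p : ℕ
  /-- `p` is prime. -/
  hp : p.Prime
  /-- The level `M`. -/
  M : ℕ
  /-- `V` is killed by `p^M`. -/
  torsion : ∀ v : V, ((p : ℤ) ^ M) • v = 0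
  /-- The two eigengroups `V^{ν} = eig ν`, `ν = ±1` (values at other integers are never used). -/
  eig : ℤ → AddSubgroup V
  /-- `V⁺ ∩ V⁻ = 0`. -/
  eig_disjoint : ∀ v : V, v ∈ eig 1 → v ∈ eig (-1) → v = 0
  /-- The Selmer group `Sel ≤ V`. -/
  Sel : AddSubgroup V
  /-- `Sel` is split: every Selmer class is a sum of a Selmer class in `V⁺` and one in `V⁻`. -/
  sel_split : ∀ s ∈ Sel, ∃ s₁ s₂ : V, (s₁ ∈ Sel ∧ s₁ ∈ eig 1) ∧ (s₂ ∈ Sel ∧ s₂ ∈ eig (-1)) ∧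
    s = s₁ + s₂
  /-- The Selmer local conditions, indexed by the places `v`. -/
  Loc : Pl → AddSubgroup V
  /-- `Sel` is cut out by the local conditions at all places. -/
  mem_sel_iff : ∀ s, s ∈ Sel ↔ ∀ v, s ∈ Loc v
  /-- Kolyvagin primes `ℓ ∈ S₁(M)`. -/
  Kol : ℕ → Prop
  /-- Kolyvagin primes are primes. -/
  prime_of_kol : ∀ ℓ, Kol ℓ → ℓ.Prime
  /-- The place attached to a Kolyvagin prime (arbitrary off `Kol`). -/
  pl : ℕ → Pl
  /-- "The place `v` divides `n`". -/
  Dv : Pl → ℕ → Prop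
  /-- `pl ℓ` is the unique place dividing the Kolyvagin prime `ℓ`. -/
  dv_iff : ∀ ℓ, Kol ℓ → ∀ v, Dv v ℓ ↔ v = pl ℓ
  /-- A place dividing `ℓ ℓ'` divides `ℓ` or `ℓ'`. -/
  dv_mul : ∀ ℓ ℓ', Kol ℓ → Kol ℓ' → ∀ v, Dv v (ℓ * ℓ') → Dv v ℓ ∨ Dv v ℓ'
  /-- The strict local conditions "`c_λ = 0`" at Kolyvagin primes. -/
  A : ℕ → AddSubgroup V
  /-- `x = δ_M x₀`, `y_K ≡ p^{M₀} x₀` modulo torsion, `x₀` not divisible by `p`. -/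
  x : V
  /-- `x ∈ Sel`. -/
  x_mem : x ∈ Sel
  /-- `x` has order `p^M`. -/
  x_ord : ((p : ℤ) ^ (M - 1)) • x ≠ 0
  /-- `M₀ = ord_p [E(K) : ℤ y_K]` (McCallum 1991, Lemma 5.1). -/
  M₀ : ℕ
  /-- The sign `ε` of `y_K`, as `±1`. -/
  ε : ℤ
  /-- `ε = ±1`. -/
  hε : ε = 1 ∨ ε = -1
  /-- `x` lies in the `ε`-eigengroup. -/
  x_eig : x ∈ eig ε
  /-- Kolyvagin's classes `c_M(n)`; only square-free products of Kolyvagin primes matter. -/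
  c : ℕ → V
  /-- `c_M(1) = δ_M y_K = p^{M₀} x`. -/
  c_one : c 1 = ((p : ℤ) ^ M₀) • x
  /-- **Gross 1991, Prop. 5.4 (2)**: `c_M(n)` lies in the `ε (-1)^{r}`-eigengroup, `r` the number
  of prime factors of `n`. -/
  c_eig : ∀ n, KolSupp Kol n → c n ∈ eig (ε * (-1) ^ n.primeFactors.card)
  /-- **McCallum 1991, Lemma 4.3**: `c_M(n)_v ∈ δ(E(K_v))` at every place `v` prime to `n`. -/
  c_mem_loc : ∀ n, KolSupp Kol n → ∀ v, ¬ Dv v n → c n ∈ Loc v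
  /-- **McCallum 1991, Prop. 4.4**: for `n = ℓ m` and every `a`,
  `p^a d_M(n)_λ = 0 ↔ p^a c_M(m)_λ = 0`. -/
  c_mem_loc_iff : ∀ ℓ m, Kol ℓ → KolSupp Kol (ℓ * m) → ∀ a : ℕ,
    (((p : ℤ) ^ a) • c (ℓ * m) ∈ Loc (pl ℓ)) ↔ ((p : ℤ) ^ a) • c m ∈ A ℓ

namespace SplitDataM

variable {V : Type*} [AddCommGroup V] {Pl : Type*} (S : SplitDataM V Pl)

/-! ### Exponents: `ord s = p^{expo s}` -/

/-- `expo s`: the least `a` with `p^a • s = 0`, so that `ord s = p^{expo s}` — McCallum's `N` with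
`ord(d) = p^{N}`. [cite: McCallumLMS1991, §5 (Thm. 5.4: `N_i` with `ord d_i = p^{N_i}`, PDF p. 288)] -/
def expo (s : V) : ℕ :=
  Nat.find (⟨S.M, S.torsion s⟩ : ∃ a : ℕ, ((S.p : ℤ) ^ a) • s = 0)

/-- **The defining property of `expo`**: `p^{expo s} • s = 0` and `p^a • s ≠ 0` for `a < expo s`.
[cite: McCallumLMS1991, §5 (Thm. 5.4: orders `ord d = p^{N}`, PDF p. 288)] -/
theorem expo_spec (s : V) :
    ((S.p : ℤ) ^ S.expo s) • s = 0 ∧ ∀ a < S.expo s, ((S.p : ℤ) ^ a) • s ≠ 0 :=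
  ⟨Nat.find_spec (⟨S.M, S.torsion s⟩ : ∃ a : ℕ, ((S.p : ℤ) ^ a) • s = 0),
    fun _ ha ↦ Nat.find_min _ ha⟩

/-- `expo s ≤ a ↔ p^a • s = 0`. [cite: McCallumLMS1991, §5 (Thm. 5.4: orders `ord d = p^{N}`, PDF p. 288)] -/
theorem expo_le_iff (s : V) (a : ℕ) : S.expo s ≤ a ↔ ((S.p : ℤ) ^ a) • s = 0 :=
  ⟨fun h ↦ pow_zsmul_eq_zero_of_le h (S.expo_spec s).1,
    fun h ↦ Nat.find_min' (⟨S.M, S.torsion s⟩ : ∃ a : ℕ, ((S.p : ℤ) ^ a) • s = 0) h⟩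

/-- `expo s ≤ M` and `expo s = 0 ↔ s = 0`. [cite: McCallumLMS1991, §5 (Thm. 5.4: orders `ord d = p^{N}`, PDF p. 288)] -/
theorem expo_le_M_and_eq_zero_iff (s : V) : S.expo s ≤ S.M ∧ (S.expo s = 0 ↔ s = 0) := by
  refine ⟨(S.expo_le_iff s S.M).mpr (S.torsion s), fun h ↦ ?_, fun h ↦ ?_⟩
  · have := (S.expo_spec s).1
    rwa [h, pow_zero, one_smul] at this
  · exact Nat.le_zero.mp ((S.expo_le_iff s 0).mpr (by rw [h, smul_zero]))

/-- `ord s = p^{expo s}`. [cite: McCallumLMS1991, §5 (Thm. 5.4: orders `ord d = p^{N}`, PDF p. 288)] -/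
theorem addOrderOf_eq_pow_expo (s : V) : addOrderOf s = S.p ^ S.expo s := by
  by_cases hs : s = 0
  · rw [(S.expo_le_M_and_eq_zero_iff s).2.mpr hs, hs, pow_zero, addOrderOf_zero]
  · have hne : S.expo s ≠ 0 := fun h ↦ hs ((S.expo_le_M_and_eq_zero_iff s).2.mp h)
    exact KolyvaginDescent.addOrderOf_eq_prime_pow S.hp (S.expo_spec s).1
      ((S.expo_spec s).2 _ (Nat.sub_one_lt hne))

/-! ### The class `x` -/

/-- `x` has order exactly `p^M` (`k • x = 0 ↔ p^M ∣ k`), `expo x = M ≠ 0`. [cite: McCallumLMS1991, Lemma 5.1 (PDF p. 288)] -/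
theorem expo_x_and_zsmul_x_eq_zero_iff :
    S.expo S.x = S.M ∧ S.M ≠ 0 ∧ ∀ k : ℤ, k • S.x = 0 ↔ ((S.p : ℤ) ^ S.M) ∣ k := by
  have hM : S.M ≠ 0 := by
    intro h
    apply S.x_ord
    have := S.torsion S.x
    rwa [h] at this ⊢
  refine ⟨le_antisymm (S.expo_le_M_and_eq_zero_iff S.x).1 ?_, hM,
    fun k ↦ zsmul_eq_zero_iff_prime_pow_dvd S.hp (S.torsion S.x) S.x_ord k⟩
  by_contra hlt
  exact S.x_ord ((S.expo_le_iff S.x (S.M - 1)).mp (by omega))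

/-! ### Signs -/

/-- The signs `ε (-1)^i` are `±1`. [cite: GrossLMS1991, Prop. 5.4 (2)] -/
theorem sign_pow_cases (i : ℕ) : S.ε * (-1) ^ i = 1 ∨ S.ε * (-1) ^ i = -1 := by
  rcases S.hε with h | h <;> rcases neg_one_pow_eq_or ℤ i with h' | h' <;> simp [h, h']

/-- `V^{e} ∩ V^{-e} = 0` for a sign `e = ±1`. [cite: McCallumLMS1991, §5 (the `±`-eigenspaces, PDF p. 287)] -/
theorem eq_zero_of_mem_eig_of_mem_eig_neg {e : ℤ} (he : e = 1 ∨ e = -1) {v : V}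
    (h₁ : v ∈ S.eig e) (h₂ : v ∈ S.eig (-e)) : v = 0 := by
  rcases he with rfl | rfl
  · exact S.eig_disjoint v h₁ h₂
  · rw [neg_neg] at h₂
    exact S.eig_disjoint v h₂ h₁

/-! ### Square-free products with one more Kolyvagin prime -/

/-- `ℓ n ∈ S_{r+1}` for `n ∈ S_r` and a Kolyvagin prime `ℓ ∤ n`. [cite: GrossLMS1991, §3 (3.1)–(3.2)] -/
theorem kolSupp_mul_of_not_dvd {ℓ n : ℕ} (hℓ : S.Kol ℓ) (hn : KolSupp S.Kol n) (hℓn : ¬ ℓ ∣ n) :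
    KolSupp S.Kol (ℓ * n) := by
  have hℓp := S.prime_of_kol ℓ hℓ
  refine ⟨?_, fun q hq ↦ ?_⟩
  · rw [Nat.squarefree_mul_iff]
    exact ⟨(Nat.Prime.coprime_iff_not_dvd hℓp).mpr hℓn, hℓp.squarefree, hn.1⟩
  · rw [Nat.primeFactors_mul hℓp.ne_zero hn.1.ne_zero, Finset.mem_union, hℓp.primeFactors,
      Finset.mem_singleton] at hq
    rcases hq with rfl | hq
    · exact hℓ
    · exact hn.2 q hq

/-- `ℓ n` has one more prime factor than `n` (`ℓ` prime, `ℓ ∤ n`, `n ≠ 0`). [cite: GrossLMS1991, §3 (3.1)–(3.2)] -/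
theorem card_primeFactors_mul_of_not_dvd {ℓ n : ℕ} (hℓ : ℓ.Prime) (hn : n ≠ 0) (hℓn : ¬ ℓ ∣ n) :
    (ℓ * n).primeFactors.card = n.primeFactors.card + 1 := by
  rw [Nat.primeFactors_mul hℓ.ne_zero hn, hℓ.primeFactors, ← Finset.insert_eq,
    Finset.card_insert_of_notMem fun h ↦ hℓn (Nat.dvd_of_mem_primeFactors h)]

end SplitDataM

/-! ## The forgetful map from the full hypotheses -/

namespace SplitHypothesesM

variable {V : Type*} [AddCommGroup V] {Pl : Type*} (S : SplitHypothesesM V Pl)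

/-- The data underlying Kolyvagin's split descent hypotheses (forget `duality` and `cebotarev`).
[folklore] -/
def toData : SplitDataM V Pl where
  p := S.p
  hp := S.hp
  M := S.M
  torsion := S.torsion
  eig := S.eig
  eig_disjoint := S.eig_disjoint
  Sel := S.Sel
  sel_split := S.sel_split
  Loc := S.Loc
  mem_sel_iff := S.mem_sel_iff
  Kol := S.Kol
  prime_of_kol := S.prime_of_kol
  pl := S.pl
  Dv := S.Dv
  dv_iff := S.dv_iff
  dv_mul := S.dv_mul
  A := S.A
  x := S.x
  x_mem := S.x_mem
  x_ord := S.x_ord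
  M₀ := S.M₀
  ε := S.ε
  hε := S.hε
  x_eig := S.x_eig
  c := S.c
  c_one := S.c_one
  c_eig := S.c_eig
  c_mem_loc := S.c_mem_loc
  c_mem_loc_iff := S.c_mem_loc_iff

end SplitHypothesesM

end KolyvaginDescent

end Literature.NumberTheory.EllipticCurves
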